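import Summits.CriticalPhenomena.PercolationContinuityZ3.Theorems.PercNearOneGluingNoHeavyLowerTailLevelPackingTools
import HarnessLib

/-!
# `NoHeavyLowerTail` (stmt-CriticalPhenomena-4575) — the LEVEL PACKING lemma
# (Kozma–Nitzan's Lemma 2 chain with a JOINED target block)

Bond percolation `μ = prodBernoulli w` on `Fin n`, an observer `o`, relays `A`, a "target block" `T ⊆ A`, a
partition `π` of `T` into source blocks `S`, and for the active blocks `S ∈ π' ⊆ π` increasing guards `Q_S`
determined by the cluster of `A ∖ S` (as in `Theorems.guardedBlockLonelyRelay`).  Write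
`E_S = {o ↔ S}`, `D_S = {S ↮ A ∖ S}`, `J_T = {T pairwise joined}`, `Tgt = J_T ∩ D_T`
(= "the relay partition has `T` as a block", the remaining relays `A ∖ T` unconstrained).  Then

  `(Σ_{S ∈ π'} μ(E_S ∩ D_S ∩ Q_S)) · μ(Tgt) ≤ t · μ(E_T ∩ Tgt)`   whenever `μ(D_S ∩ Q_S) ≤ t` for all `S ∈ π'`

(`levelPacking`; `levelPacking_of_pos` when `μ(M) > 0`), i.e. in ratio form
`Σ_S P(o ↔ S | D_S ∩ Q_S) ≤ P(o ↔ T | Π has block T)` when the source weights `μ(D_S ∩ Q_S)` are equal.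
The point is `|T| ≥ 2`: small-block sources are packed into ONE big-block target — the level-`j ≥ 2`
replacement for the singleton packing `Σ_x P(o ↔ x | all separated) ≤ 1` behind the lonely relay lemma
(KN Lemma 2), found by the assembly-LP analysis of the `|A| = 5` rung (prim-gen-swap gen 2, NOTES H3–H7): the
per-law LP certificates of CIL(5,2) use exactly these inequalities (targets `T = A∖c` and triples, sources =
singletons and pairs with "the rest is joined" guards).  Steps (`…LevelPackingTools`): source step per block
(BHK Thm 1.5 for sets + block terminal separation), disjointness of the `E_S ∩ M`, target step (BHK Thm 1.3 for the
set `T` given `{T ↮ A∖T}`, twice); `μ(M) = 0` is removed by scaling the weights (`stub_weightContinuity`).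
-/

noncomputable section

namespace Summit.CriticalPhenomena.PercolationContinuityZ3.Theorems

open scoped BigOperators Classical Topology
open MeasureTheory Set Filter
open Literature.Probability.LatticeModels (prodBernoulli)
open Literature.Probability.Percolation
open BlockLonelyRelay GuardedBlockLonelyRelay AttachedChampionLevelOne

variable {n : ℕ}

namespace LevelPacking

/-- **Level packing when `μ(M) > 0`.** [this file] -/
theorem levelPacking_of_pos (w : Sym2 (Fin n) → unitInterval) (A T : Finset (Fin n)) (hTA : T ⊆ A)
    (o : Fin n) (π π' : Finset (Finset (Fin n))) (hπ' : π' ⊆ π) (hsub : ∀ S ∈ π, S ⊆ T)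
    (hcover : ∀ t ∈ T, ∃ S ∈ π, t ∈ S) (hdisj : ∀ S ∈ π, ∀ S' ∈ π, S ≠ S' → Disjoint S S')
    (Q : Finset (Fin n) → Set (BondConfig (Fin n)))
    (hQ : ∀ S ∈ π', ∃ G : Set (Sym2 (Fin n)) → ℝ, Monotone G ∧
      ∀ ω, G (⋃ t ∈ (↑(A \ S) : Set (Fin n)), openEdgeCluster ω t) = (Q S).indicator 1 ω)
    (t : ℝ) (ht : 0 ≤ t)
    (hq : ∀ S ∈ π', (prodBernoulli w).real ({ω | ∀ b ∈ S, ∀ a ∈ A \ S, ω ∉ openConn b a} ∩ Q S) ≤ t)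
    (hM : 0 < (prodBernoulli w).real {ω | ∀ S ∈ π, ∀ b ∈ S, ∀ a ∈ A \ S, ω ∉ openConn b a}) :
    (∑ S ∈ π', (prodBernoulli w).real ({ω | ∃ b ∈ S, ω ∈ openConn o b} ∩
        {ω | ∀ b ∈ S, ∀ a ∈ A \ S, ω ∉ openConn b a} ∩ Q S)) *
      (prodBernoulli w).real ({ω | ∀ t ∈ T, ∀ t' ∈ T, ω ∈ openConn t t'} ∩
        {ω | ∀ t ∈ T, ∀ a ∈ A \ T, ω ∉ openConn t a}) ≤
    t * (prodBernoulli w).real ({ω | ∃ t ∈ T, ω ∈ openConn o t} ∩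
      ({ω | ∀ t ∈ T, ∀ t' ∈ T, ω ∈ openConn t t'} ∩ {ω | ∀ t ∈ T, ∀ a ∈ A \ T, ω ∉ openConn t a})) := by
  set μ := prodBernoulli w with hμ
  set M : Set (BondConfig (Fin n)) := {ω | ∀ S ∈ π, ∀ b ∈ S, ∀ a ∈ A \ S, ω ∉ openConn b a} with hMdef
  set Tgt : Set (BondConfig (Fin n)) := {ω | ∀ t ∈ T, ∀ t' ∈ T, ω ∈ openConn t t'} ∩
    {ω | ∀ t ∈ T, ∀ a ∈ A \ T, ω ∉ openConn t a} with hTgt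
  set ET : Set (BondConfig (Fin n)) := {ω | ∃ t ∈ T, ω ∈ openConn o t} with hET
  have hsubA : ∀ S ∈ π, S ⊆ A := fun S hS => (hsub S hS).trans hTA
  -- source steps, summed
  have h1 : (∑ S ∈ π', μ.real ({ω | ∃ b ∈ S, ω ∈ openConn o b} ∩
      {ω | ∀ b ∈ S, ∀ a ∈ A \ S, ω ∉ openConn b a} ∩ Q S)) * μ.real M ≤
      t * ∑ S ∈ π', μ.real ({ω | ∃ b ∈ S, ω ∈ openConn o b} ∩ M) := by
    rw [Finset.sum_mul, Finset.mul_sum]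
    refine Finset.sum_le_sum fun S hS => ?_
    obtain ⟨G, hG, hGQ⟩ := hQ S hS
    exact sourceStep w A o π hsubA hdisj (hπ' hS) (Q S) G hG hGQ t ht (hq S hS)
  -- disjointness: `Σ_{S ∈ π'} μ(E_S ∩ M) ≤ μ(E_T ∩ M)`
  have h2 : ∑ S ∈ π', μ.real ({ω | ∃ b ∈ S, ω ∈ openConn o b} ∩ M) ≤ μ.real (ET ∩ M) := by
    rw [← measureReal_biUnion_finset ((pairwiseDisjoint_join_inter π o hsubA hdisj).subset
      (Finset.coe_subset.2 hπ')) (fun S _ => MeasurableSet.of_discrete)]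
    refine measureReal_mono (Set.iUnion₂_subset fun S hS => ?_)
    rintro ω ⟨⟨b, hb, hob⟩, hωM⟩
    exact ⟨⟨b, hsub S (hπ' hS) hb, hob⟩, hωM⟩
  -- target step
  have h3 : μ.real (ET ∩ M) * μ.real Tgt ≤ μ.real M * μ.real (ET ∩ Tgt) := by
    have := targetStep w A T π hsub o
    rw [← M_eq A T π hTA hsub hcover hdisj] at this
    exact this
  have hT0 : 0 ≤ μ.real Tgt := measureReal_nonneg
  have h4 : (∑ S ∈ π', μ.real ({ω | ∃ b ∈ S, ω ∈ openConn o b} ∩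
      {ω | ∀ b ∈ S, ∀ a ∈ A \ S, ω ∉ openConn b a} ∩ Q S)) * μ.real Tgt * μ.real M ≤
      t * μ.real (ET ∩ Tgt) * μ.real M := by
    calc (∑ S ∈ π', μ.real ({ω | ∃ b ∈ S, ω ∈ openConn o b} ∩
            {ω | ∀ b ∈ S, ∀ a ∈ A \ S, ω ∉ openConn b a} ∩ Q S)) * μ.real Tgt * μ.real M
        = (∑ S ∈ π', μ.real ({ω | ∃ b ∈ S, ω ∈ openConn o b} ∩
            {ω | ∀ b ∈ S, ∀ a ∈ A \ S, ω ∉ openConn b a} ∩ Q S)) * μ.real M * μ.real Tgt := by ring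
      _ ≤ (t * ∑ S ∈ π', μ.real ({ω | ∃ b ∈ S, ω ∈ openConn o b} ∩ M)) * μ.real Tgt :=
          mul_le_mul_of_nonneg_right h1 hT0
      _ ≤ (t * μ.real (ET ∩ M)) * μ.real Tgt :=
          mul_le_mul_of_nonneg_right (mul_le_mul_of_nonneg_left h2 ht) hT0
      _ = t * (μ.real (ET ∩ M) * μ.real Tgt) := by ring
      _ ≤ t * (μ.real M * μ.real (ET ∩ Tgt)) := mul_le_mul_of_nonneg_left h3 ht
      _ = t * μ.real (ET ∩ Tgt) * μ.real M := by ring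
  exact le_of_mul_le_mul_right h4 hM

end LevelPacking

open LevelPacking in
/-- **The level packing lemma (unconditional).**  For `μ = prodBernoulli w` on `Fin n`, an observer `o`,
relays `A`, a target block `T ⊆ A`, a partition `π` of `T` into blocks, active blocks `π' ⊆ π` with
increasing guards `Q_S` determined by the cluster of `A ∖ S` (`1_{Q_S} = G_S(⋃_{t ∈ A∖S} C_t)`, `G_S`
monotone) and a common bound `μ({S ↮ A∖S} ∩ Q_S) ≤ t` (`S ∈ π'`):
`(Σ_{S ∈ π'} μ({o ↔ S} ∩ {S ↮ A∖S} ∩ Q_S)) · μ(Tgt) ≤ t · μ({o ↔ T} ∩ Tgt)`,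
`Tgt = {T pairwise joined} ∩ {T ↮ A ∖ T}` ("the relay partition has the block `T`").
[cite: KozmaNitzan2024, Lemmas 1–2 (pp. 5–6); VandenbergHaggstromKahn2005, Thms. 1.3, 1.5] -/
theorem levelPacking (w : Sym2 (Fin n) → unitInterval) (A T : Finset (Fin n)) (hTA : T ⊆ A)
    (o : Fin n) (π π' : Finset (Finset (Fin n))) (hπ' : π' ⊆ π) (hsub : ∀ S ∈ π, S ⊆ T)
    (hcover : ∀ t ∈ T, ∃ S ∈ π, t ∈ S) (hdisj : ∀ S ∈ π, ∀ S' ∈ π, S ≠ S' → Disjoint S S')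
    (Q : Finset (Fin n) → Set (BondConfig (Fin n)))
    (hQ : ∀ S ∈ π', ∃ G : Set (Sym2 (Fin n)) → ℝ, Monotone G ∧
      ∀ ω, G (⋃ t ∈ (↑(A \ S) : Set (Fin n)), openEdgeCluster ω t) = (Q S).indicator 1 ω)
    (t : ℝ) (ht : 0 ≤ t)
    (hq : ∀ S ∈ π', (prodBernoulli w).real ({ω | ∀ b ∈ S, ∀ a ∈ A \ S, ω ∉ openConn b a} ∩ Q S) ≤ t) :
    (∑ S ∈ π', (prodBernoulli w).real ({ω | ∃ b ∈ S, ω ∈ openConn o b} ∩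
        {ω | ∀ b ∈ S, ∀ a ∈ A \ S, ω ∉ openConn b a} ∩ Q S)) *
      (prodBernoulli w).real ({ω | ∀ t ∈ T, ∀ t' ∈ T, ω ∈ openConn t t'} ∩
        {ω | ∀ t ∈ T, ∀ a ∈ A \ T, ω ∉ openConn t a}) ≤
    t * (prodBernoulli w).real ({ω | ∃ t ∈ T, ω ∈ openConn o t} ∩
      ({ω | ∀ t ∈ T, ∀ t' ∈ T, ω ∈ openConn t t'} ∩ {ω | ∀ t ∈ T, ∀ a ∈ A \ T, ω ∉ openConn t a})) := by
  have hsubA : ∀ S ∈ π, S ⊆ A := fun S hS => (hsub S hS).trans hTA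
  -- scaled weights `w_k = (1 - 1/(k+1)) • w`, all `< 1`, converging to `w`
  have hcmem : ∀ k : ℕ, ((1 : ℝ) - 1 / ((k : ℝ) + 1)) ∈ unitInterval := by
    intro k
    have hk : (0 : ℝ) < (k : ℝ) + 1 := Nat.cast_add_one_pos k
    have h1 : 1 / ((k : ℝ) + 1) ≤ 1 := by
      rw [div_le_one hk]; linarith [(Nat.cast_nonneg k : (0 : ℝ) ≤ k)]
    have h0 : 0 ≤ 1 / ((k : ℝ) + 1) := by positivity
    exact ⟨by linarith, by linarith⟩
  set wk : ℕ → Sym2 (Fin n) → unitInterval :=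
    fun k e => ⟨(1 - 1 / ((k : ℝ) + 1)) * (w e : ℝ), unitInterval.mul_mem (hcmem k) (w e).2⟩
    with hwk_def
  have hwk_lt : ∀ k e, ((wk k e : unitInterval) : ℝ) < 1 := by
    intro k e
    have hk : (0 : ℝ) < (k : ℝ) + 1 := Nat.cast_add_one_pos k
    have hc : (1 : ℝ) - 1 / ((k : ℝ) + 1) < 1 := by
      have : 0 < 1 / ((k : ℝ) + 1) := by positivity
      linarith
    calc ((wk k e : unitInterval) : ℝ) = (1 - 1 / ((k : ℝ) + 1)) * (w e : ℝ) := rfl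
      _ ≤ (1 - 1 / ((k : ℝ) + 1)) := mul_le_of_le_one_right (hcmem k).1 (w e).2.2
      _ < 1 := hc
  have hc_lim : Tendsto (fun k : ℕ => (1 : ℝ) - 1 / ((k : ℝ) + 1)) atTop (𝓝 1) := by
    simpa using tendsto_const_nhds.sub (tendsto_one_div_add_atTop_nhds_zero_nat (𝕜 := ℝ))
  have hwk_lim : Tendsto wk atTop (𝓝 w) := by
    refine tendsto_pi_nhds.2 fun e => ?_
    rw [tendsto_subtype_rng]
    have h := hc_lim.mul_const (w e : ℝ)
    rw [one_mul] at h
    exact h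
  have hlimE : ∀ E : Set (Set (Sym2 (Fin n))),
      Tendsto (fun k => (prodBernoulli (wk k)).real E) atTop (𝓝 ((prodBernoulli w).real E)) :=
    fun E => ((stub_weightContinuity n E).tendsto w).comp hwk_lim
  set δ : ℕ → ℝ := fun k => ∑ S ∈ π',
      |(prodBernoulli (wk k)).real ({ω | ∀ b ∈ S, ∀ a ∈ A \ S, ω ∉ openConn b a} ∩ Q S) -
        (prodBernoulli w).real ({ω | ∀ b ∈ S, ∀ a ∈ A \ S, ω ∉ openConn b a} ∩ Q S)| with hδ_def
  have hδ0 : ∀ k, 0 ≤ δ k := fun k => Finset.sum_nonneg fun S _ => abs_nonneg _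
  have hδ_lim : Tendsto δ atTop (𝓝 0) := by
    have h : ∀ S ∈ π', Tendsto (fun k =>
        |(prodBernoulli (wk k)).real ({ω | ∀ b ∈ S, ∀ a ∈ A \ S, ω ∉ openConn b a} ∩ Q S) -
          (prodBernoulli w).real ({ω | ∀ b ∈ S, ∀ a ∈ A \ S, ω ∉ openConn b a} ∩ Q S)|) atTop (𝓝 0) := by
      intro S _
      simpa using (tendsto_sub_nhds_zero_iff.2
        (hlimE ({ω | ∀ b ∈ S, ∀ a ∈ A \ S, ω ∉ openConn b a} ∩ Q S))).abs
    simpa [hδ_def] using tendsto_finsetSum π' h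
  have hk : ∀ k, (∑ S ∈ π', (prodBernoulli (wk k)).real ({ω | ∃ b ∈ S, ω ∈ openConn o b} ∩
      {ω | ∀ b ∈ S, ∀ a ∈ A \ S, ω ∉ openConn b a} ∩ Q S)) *
      (prodBernoulli (wk k)).real ({ω | ∀ t ∈ T, ∀ t' ∈ T, ω ∈ openConn t t'} ∩
        {ω | ∀ t ∈ T, ∀ a ∈ A \ T, ω ∉ openConn t a}) ≤
      (t + δ k) * (prodBernoulli (wk k)).real ({ω | ∃ t ∈ T, ω ∈ openConn o t} ∩
        ({ω | ∀ t ∈ T, ∀ t' ∈ T, ω ∈ openConn t t'} ∩ {ω | ∀ t ∈ T, ∀ a ∈ A \ T, ω ∉ openConn t a})) := by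
    intro k
    refine levelPacking_of_pos (wk k) A T hTA o π π' hπ' hsub hcover hdisj Q hQ (t + δ k)
      (by linarith [hδ0 k]) ?_ ?_
    · intro S hS
      have h1 := hq S hS
      have h2 : |(prodBernoulli (wk k)).real ({ω | ∀ b ∈ S, ∀ a ∈ A \ S, ω ∉ openConn b a} ∩ Q S) -
            (prodBernoulli w).real ({ω | ∀ b ∈ S, ∀ a ∈ A \ S, ω ∉ openConn b a} ∩ Q S)| ≤ δ k :=
        Finset.single_le_sum (f := fun S =>
          |(prodBernoulli (wk k)).real ({ω | ∀ b ∈ S, ∀ a ∈ A \ S, ω ∉ openConn b a} ∩ Q S) -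
            (prodBernoulli w).real ({ω | ∀ b ∈ S, ∀ a ∈ A \ S, ω ∉ openConn b a} ∩ Q S)|)
          (fun S _ => abs_nonneg _) hS
      have h3 := le_abs_self
        ((prodBernoulli (wk k)).real ({ω | ∀ b ∈ S, ∀ a ∈ A \ S, ω ∉ openConn b a} ∩ Q S) -
          (prodBernoulli w).real ({ω | ∀ b ∈ S, ∀ a ∈ A \ S, ω ∉ openConn b a} ∩ Q S))
      linarith
    · exact lt_of_lt_of_le (singleFinger_pairSep_real_pos (wk k) (hwk_lt k) A)
        (measureReal_mono (sepAll_subset_M A π hsubA hdisj))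
  have hlimL : Tendsto (fun k => (∑ S ∈ π', (prodBernoulli (wk k)).real ({ω | ∃ b ∈ S, ω ∈ openConn o b} ∩
      {ω | ∀ b ∈ S, ∀ a ∈ A \ S, ω ∉ openConn b a} ∩ Q S)) *
      (prodBernoulli (wk k)).real ({ω | ∀ t ∈ T, ∀ t' ∈ T, ω ∈ openConn t t'} ∩
        {ω | ∀ t ∈ T, ∀ a ∈ A \ T, ω ∉ openConn t a})) atTop
      (𝓝 ((∑ S ∈ π', (prodBernoulli w).real ({ω | ∃ b ∈ S, ω ∈ openConn o b} ∩
        {ω | ∀ b ∈ S, ∀ a ∈ A \ S, ω ∉ openConn b a} ∩ Q S)) *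
        (prodBernoulli w).real ({ω | ∀ t ∈ T, ∀ t' ∈ T, ω ∈ openConn t t'} ∩
          {ω | ∀ t ∈ T, ∀ a ∈ A \ T, ω ∉ openConn t a}))) :=
    (tendsto_finsetSum π' fun S _ => hlimE _).mul (hlimE _)
  have hlimR : Tendsto (fun k => (t + δ k) * (prodBernoulli (wk k)).real ({ω | ∃ t ∈ T, ω ∈ openConn o t} ∩
        ({ω | ∀ t ∈ T, ∀ t' ∈ T, ω ∈ openConn t t'} ∩ {ω | ∀ t ∈ T, ∀ a ∈ A \ T, ω ∉ openConn t a})))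
      atTop (𝓝 (t * (prodBernoulli w).real ({ω | ∃ t ∈ T, ω ∈ openConn o t} ∩
        ({ω | ∀ t ∈ T, ∀ t' ∈ T, ω ∈ openConn t t'} ∩ {ω | ∀ t ∈ T, ∀ a ∈ A \ T, ω ∉ openConn t a})))) := by
    have h1 : Tendsto (fun k => t + δ k) atTop (𝓝 t) := by simpa using tendsto_const_nhds.add hδ_lim
    exact h1.mul (hlimE _)
  exact le_of_tendsto_of_tendsto' hlimL hlimR hk

end Summit.CriticalPhenomena.PercolationContinuityZ3.Theorems

end
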